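import Literature.MathematicalPhysics.QuantumFieldTheory.Balaban1983to89.B8Thm4SupportLocal
import Literature.MathematicalPhysics.QuantumFieldTheory.Balaban1983to89.B8LeafModelZdPer

/-!
# `Balaban1983to89.B8Thm4SupportLocalPer` — [Balaban1985RegularSpaces] THEOREM 4 (p. 88): THE LEVEL INDUCTION (pp. 88–89, 94–95) WITH THE **PERIODICITY INVARIANT**
# — dag-n05-a's support-invariant driver `B8Thm4SupportLocal.thm4_exists_all_levels_supp` re-run so that EVERY Proposition-5 ∕ Proposition-3 call of the induction is made at
# `P`-PERIODIC data only (print's torus `T_η`, p. 77, read on `ℤᵈ`): the first brick of the periodic-ARGUMENT edition of Theorems 2 ∕ 4 ∕ 8 on the (β′-PERIODIC) road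

statement-level skeleton of published theorems with citation tags; proofs where landed; nothing here is a claim about the Yang–Mills mass gap

T. Bałaban, *Spaces of regular gauge field configurations on a lattice and gauge fixing conditions*, Commun. Math. Phys. **99** (1985) 75–102
`[Balaban1985RegularSpaces]` ("B8"; journal page = PDF page + 74): Thm 4 p. 88, proof pp. 88–89 («by induction with respect to k») and pp. 94–95 ((1.107)–(1.111)),
Prop. 5 p. 94, Prop. 3 p. 87, (1.17) p. 78, (1.29) p. 81, p. 77 («Ω_j ⊂ T_η … we admit the case where some domains Ω_j are equal to T_η»).  `[Balaban1985Averaging]` (4) p. 18 (the torus).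

## THE PRINTED TEXT (p. 88 and pp. 94–95, verbatim)

p. 88: *«We prove this theorem by induction with respect to k … Let us assume that the theorem holds for k, thus we have the configuration U₁ …, U₁U₀ = (U′U₀)^{u₁},
satisfying (1.36)–(1.39).»*; p. 95: *«Applying Proposition 5 … we get a function λ … Let us define v = exp iλ, U₂U₀ = (U₁U₀)^v … (1.110) … hence |A₂| < (2(B₁+B₂)(α₀+α₁) + 8α₄)(Lʲη)⁻¹
(1.111) … Applying Proposition 3 we get that U₂ satisfies (1.36)–(1.39) with k + 1 instead of k.»*  Every configuration, gauge transformation and function in this induction lives on the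
FINITE torus `T_η` (p. 77) — read on `ℤᵈ`: is `P`-PERIODIC.

## WHY THIS FILE (cell `pub-ymgap`, HUMAN RULING D-0062; width seat `pub-ymgap-dag-n05-w1` (g4), CLAIM-7 on the cell bus 2026-08-28 15:41Z; director-ym №217 (1)(b):
## «a discharge conditional on N06 object binders at Ω₀ = ℤᵈ is NOT a discharge»)

On the (β′-PERIODIC) road the Theorem-2∕4∕8 conjuncts of N05's display come (under P4 ANSWER (ii)) from dag-n05-c's transfers of the ℤᵈ MEMBER theorems, whose Theorem-4-shaped core
(`B8Thm4CoreZdGF3HPLanEGamma.thm4Core_zdGF3HP_map_lanE_γ'`) displays the sockets `SP5base ∕ SP5 ∕ SH59src ∕ SP5u` quantified over ALL gauge transformations, configurations and exponent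
fields on `ℤᵈ` — Proposition 5 and [4] Thm 3.3 IN INFINITE VOLUME, which no torus object supplies (the species this seat's `B8LeafModelZdPerProp3OfSockPer` ∕
`B8Prop3PrintedZdGF3P2GammaOfSockPer` removed for Proposition 3).  Those sockets are consumed INSIDE the level induction `B8Thm4SupportLocal.thm4_exists_all_levels_supp` (dag-n05-a g4):
at step `m ↦ m + 1` Proposition 5 is called at the datum `(u_m, U_m, A_m)` the previous step produced, the step sets `u_{m+1} := u_m·v`, `W := U_m^{v⁻¹}`, `A′ := (1∕iη) log W`, and
Proposition 3 (the reset of (1.111)'s constant) is called at `(u_{m+1}, W, A′)`.  That driver ALREADY threads one invariant through the induction — the support clause «`u = 1` off `S`»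
(Prop. 5 assumes it for `u_m` and delivers it for `v`).  THIS FILE threads a second one, PERIODICITY, the same way: if `U₀`, `U′` are `P`-periodic and every Proposition-5 call at
periodic data delivers a periodic `v`, then every object of the induction is periodic — `u_m·v` (product), `U_m^{v⁻¹}` (the moving-frame action (55) of periodic data,
`B8LeafModelZdPer.isPeriodic_mgauge ∕ isPeriodic_inv`), `(1∕iη) log W` (bondwise) — so Proposition 5 and Proposition 3 are only ever asked at PERIODIC `(u, W, A)`: the GUARDED sockets a
torus Proposition 5 (cell `lit-balaban`'s `B8Prop5UniqSectEWPer`-type suppliers, to be generalised from `Ω ≡ T_η` to nested periodic domains) and a torus [4] Thm 3.3 (dag-n06's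
`opsAllZdPer` suppliers) can answer.  The step is dag-n05-a's `thm4_exists_step_onBonds_supp` with its exponent WITNESS EXPOSED (§1: `A′ := (1∕iη) log (U_m^{v⁻¹})` instead of `∃ A′`), so
the invariant can read it.

## WHAT IS PROVED (kernel, 0 sorry, 0 def)

* §1 `thm4_exists_step_onBonds_supp_explicit` — the induction step (1.110)–(1.111) with the support invariant AND THE EXPONENT NAMED: `u := u₁·v`, `W := U₁^{v⁻¹}`,
  `A′ := fun y μ => η⁻¹ • (I⁻¹ • mlog (W y μ))` (dag-n05-a's proof verbatim, `∃` removed); `isPeriodic_logW` (that exponent is periodic when `W` is).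
* §2 ★★ `thm4_exists_all_levels_supp_per` — THE DRIVER WITH BOTH INVARIANTS: hypotheses `IsPeriodic P U₀`, `IsPeriodic P U′`; the Proposition-5 sockets `hP5base ∕ hP5` ASSUME
  periodicity of the level datum `(u₁, U₁, A)` and DELIVER `IsPeriodic P v`; the Proposition-3 reset socket `hP3` ASSUMES `IsPeriodic P u`, `IsPeriodic P W`, `IsPeriodic P A`; CONCLUSION
  at every `m ≤ k`: the gauge transformation `u` (unitary, `= 1` off `S`, (1.29) at `m` levels), `W = U′^{u⁻¹}` in the gauge `Lan m`, its exponent `A` with the (1.69)∕`c⋆` shape on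
  `E_j`, `j ≤ m` — ALL THREE `P`-PERIODIC.

## HONEST SCOPE

A re-run of a LANDED induction driver with one more threaded invariant; Propositions 3 ∕ 5 are NOT proved (they are the sockets `hP3 ∕ hP5base ∕ hP5`, now askable at periodic data only);
nothing of [Balaban1985RegularSpaces]'s analysis is re-proved; the compositions with the (1.42) clause, the sourced b9 socket and the uniqueness half (the bricks T2–T6 named on the bus)
are NOT in this file; count-neutral helper (K1⁹ `stmt-QuantumFields-27364`); N05 NOT discharged; no count claim; one finite `𝕋⁴` programme at fixed `ε`, Bałaban AS PRINTED; the
Yang–Mills mass gap (Clay) is NOT proved by any of this — R4 closes the conditional finite-`𝕋⁴` rung `BalabanLadder.UV` only; nothing continuum ∕ ℝ⁴ ∕ OS.  No `sorry`, no `def`, no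
`instance`, no `notation`.  Unit `pub-ymgap-dag-n05-w1` (g4), 2026-08-28.

RELATED, NOT DUPLICATED: `B8Thm4SupportLocal` (the support-invariant driver and step — the template; REUSED: `thm4_exists_step_onBonds_supp` is re-proved only to expose its witness),
`B8Thm4InductionLocal` (the original driver), `B8Thm4ExistsLocal.bond_1110_local`, `B8Thm4TruncationLocal.base_datum ∕ restr129_one` (USED by name), `B8LeafModelZdPer` §4 (periodicity
closure lemmas, USED), this seat's `B8LeafModelZdPerProp3OfSockPer.isPeriodic_logCfg` (the same bondwise remark, other letter).

[cite: Balaban1985RegularSpaces, Thm 4 p.88, proof pp.88–89 + 94–95 ((1.107)–(1.111)), Prop. 5 p.94, Prop. 3 p.87, (1.17) p.78, (1.29) p.81, p.77; Balaban1985Averaging, (4) p.18, (55) p.27]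
-/

noncomputable section

open NormedSpace

namespace Literature.MathematicalPhysics.QuantumFieldTheory.Balaban1983to89.B8Thm4SupportLocalPer

open Complex (I)
open MatrixLog B7Prop1Explicit B7Prop2Explicit B7Prop1Local B7Eq92Concrete
open B8Ineq132 (covDerivFwd InAk)
open B8Eq119TwistedAxial (Restr129 InAx)
open B8Eq184Proof (gaugeExp cfgExp)
open B8Thm4ExistsLocal (bond_1110_local)
open B8Thm4TruncationLocal (base_datum restr129_one)
open B8Prop3GaugeFixedKLevel (mem_unitaryUnits_of_mgauge_eq)
open B8Lemma1NonAbelian (mulCfg)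
open B8LeafModelZdPer (isPeriodic_mgauge isPeriodic_inv isPeriodic_const)
open T4TermwiseTorus (IsPeriodic)

-- `Site` alone could resolve to the torus sites of `Setup.lean`; re-export the `ℤ^d` sites of `B7Prop1Explicit`.
export B7Prop1Explicit (Site)

variable {d : ℕ}

/-! ## §1 The induction step with the support invariant and the exponent witness exposed; periodicity of that witness -/

section Step

variable {𝔸 : Type*} [CStarAlgebra 𝔸] [Nontrivial 𝔸]
variable {L k : ℕ} {η : ℝ} {Λ : ℕ → Set (Site d)} {U₀ U' U₁ : Site d → Fin d → 𝔸ˣ} {u₁ v : Site d → 𝔸ˣ}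
  {A : Site d → Fin d → 𝔸} {lam : Site d → 𝔸} {c α₄ : ℝ}

/-- **THE INDUCTION STEP (1.110)–(1.111) WITH THE SUPPORT INVARIANT AND THE EXPONENT NAMED** — `B8Thm4SupportLocal.thm4_exists_step_onBonds_supp` with its three witnesses
EXPOSED: the new gauge transformation `u₁·v`, the new field `W := U₁^{v⁻¹}` and ITS EXPONENT `A′ := (1∕iη) log W` (bondwise principal logarithm); proof verbatim (`bond_1110_local` +
`base_datum`). [cite: Balaban1985RegularSpaces, Thm 4 p.88, (1.110)–(1.111) p.95, (1.17) p.78] -/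
theorem thm4_exists_step_onBonds_supp_explicit (hL1 : 1 ≤ L) (hη : 0 < η)
    (hU₀ : ∀ x κ, U₀ x κ ∈ unitaryUnits 𝔸) (hU' : ∀ x κ, U' x κ ∈ unitaryUnits 𝔸)
    (hu₁ : ∀ x, u₁ x ∈ unitaryUnits 𝔸) (hv : ∀ x, v x ∈ unitaryUnits 𝔸)
    (S : Set (Site d)) (hu₁S : ∀ x, x ∉ S → u₁ x = 1) (hvS : ∀ x, x ∉ S → v x = 1)
    (hc : 0 ≤ c) (hα₄ : 0 ≤ α₄) (hs₁ : α₄ ≤ 1 / 84) (hs₂ : c ≤ 1 / 12)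
    (h₁ : mgauge U₀ u₁ U₁ = U') (E : ℕ → Set (Site d × Fin d))
    (hA : ∀ j, j ≤ k → ∀ b ∈ E j, U₁ b.1 b.2 = cfgExp η A b.1 b.2)
    (h69 : ∀ j, j ≤ k → ∀ b ∈ E j, ‖A b.1 b.2‖ ≤ c * ((L : ℝ) ^ j * η)⁻¹)
    (hvlam : ∀ j, j ≤ k → ∀ b ∈ E j,
      (v b.1 : 𝔸) = ((gaugeExp lam b.1 : 𝔸ˣ) : 𝔸) ∧ (v (b.1 + e b.2) : 𝔸) = ((gaugeExp lam (b.1 + e b.2) : 𝔸ˣ) : 𝔸))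
    (h108 : ∀ j, j ≤ k → ∀ b ∈ E j, ‖lam b.1‖ ≤ α₄ ∧ ((L : ℝ) ^ j * η) * ‖covDerivFwd η U₀ b.2 lam b.1‖ ≤ α₄)
    (Lan : (Site d → Fin d → 𝔸ˣ) → Prop) (hLan : Lan (mgauge U₀ v⁻¹ U₁)) (h129 : Restr129 L k Λ U₀ (u₁ * v)) :
    (∀ x, (u₁ * v) x ∈ unitaryUnits 𝔸) ∧ (∀ x, x ∉ S → (u₁ * v) x = 1) ∧ Restr129 L k Λ U₀ (u₁ * v) ∧
      mgauge U₀ (u₁ * v) (mgauge U₀ v⁻¹ U₁) = U' ∧ Lan (mgauge U₀ v⁻¹ U₁) ∧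
        ∀ j, j ≤ k → ∀ b ∈ E j,
          mgauge U₀ v⁻¹ U₁ b.1 b.2 = cfgExp η (fun y μ => η⁻¹ • ((I⁻¹ : ℂ) • mlog ((mgauge U₀ v⁻¹ U₁ y μ : 𝔸ˣ) : 𝔸))) b.1 b.2 ∧
            IsSelfAdjoint ((fun y μ => η⁻¹ • ((I⁻¹ : ℂ) • mlog ((mgauge U₀ v⁻¹ U₁ y μ : 𝔸ˣ) : 𝔸))) b.1 b.2) ∧
            ‖(fun y μ => η⁻¹ • ((I⁻¹ : ℂ) • mlog ((mgauge U₀ v⁻¹ U₁ y μ : 𝔸ˣ) : 𝔸))) b.1 b.2‖ ≤ (2 * c + 8 * α₄) * ((L : ℝ) ^ j * η)⁻¹ := by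
  have hLr : (1 : ℝ) ≤ L := by exact_mod_cast hL1
  have hu : ∀ x, (u₁ * v) x ∈ unitaryUnits 𝔸 := fun x => by
    rw [Pi.mul_apply]; exact (unitaryUnits 𝔸).mul_mem (hu₁ x) (hv x)
  have hW : mgauge U₀ (u₁ * v) (mgauge U₀ v⁻¹ U₁) = U' := by
    rw [B7Eq106Concrete.mgauge_mgauge, mul_assoc, mul_inv_cancel, mul_one, h₁]
  have hWu : ∀ x κ, mgauge U₀ v⁻¹ U₁ x κ ∈ unitaryUnits 𝔸 := mem_unitaryUnits_of_mgauge_eq hU₀ hU' hu hW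
  refine ⟨hu, fun x hx => ?_, h129, hW, hLan, fun j hjk b hb => ?_⟩
  · rw [Pi.mul_apply, hu₁S x hx, hvS x hx, one_mul]
  · have ht : 0 ≤ ((L : ℝ) ^ j * η)⁻¹ := by positivity
    have hpos : (0 : ℝ) < (L : ℝ) ^ j * η := by positivity
    have hηt : η * ((L : ℝ) ^ j * η)⁻¹ ≤ 1 := by
      have hLj : (1 : ℝ) ≤ (L : ℝ) ^ j := one_le_pow₀ hLr
      have e : η * ((L : ℝ) ^ j * η)⁻¹ = ((L : ℝ) ^ j)⁻¹ := by field_simp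
      rw [e]
      exact inv_le_one_of_one_le₀ hLj
    obtain ⟨hl, hD'⟩ := h108 j hjk b hb
    have hD : ‖covDerivFwd η U₀ b.2 lam b.1‖ ≤ α₄ * ((L : ℝ) ^ j * η)⁻¹ := by
      rw [← div_eq_mul_inv]
      exact (le_div_iff₀' hpos).2 hD'
    obtain ⟨hbd, hexp, hnear⟩ := bond_1110_local hη U₀ U₁ v A b.2 hc hα₄ ht hηt (hvlam j hjk b hb).1 (hvlam j hjk b hb).2
      (hA j hjk b hb) hl hD (h69 j hjk b hb) hs₁ hs₂
    obtain ⟨-, -, hsa, -⟩ := base_datum hη U₀ (mgauge U₀ v⁻¹ U₁) hWu (le_refl (1 / 4 : ℝ)) b.1 b.2 hnear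
    exact ⟨hexp.symm, hsa, hbd⟩

omit [Nontrivial 𝔸] in
/-- **The named exponent `(1∕iη) log W` of a `P`-periodic configuration is `P`-periodic** (it reads `W` at the bond only — print's functions live on the torus `T_η`).
[cite: Balaban1985RegularSpaces, (1.36) p.82 («U₁ = exp iηA»), p.77 («Ω_j ⊂ T_η»)] -/
theorem isPeriodic_logW {P : ℕ} (η : ℝ) {W : Site d → Fin d → 𝔸ˣ} (hW : IsPeriodic P W) :
    IsPeriodic P (fun y μ => η⁻¹ • ((I⁻¹ : ℂ) • mlog ((W y μ : 𝔸ˣ) : 𝔸))) := by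
  intro y m
  funext μ
  simp only [congrFun (hW y m) μ]

omit [Nontrivial 𝔸] in
/-- Pointwise products of `P`-periodic gauge transformations are `P`-periodic (`u_{m+1} = u_m·v`, p. 95). [cite: Balaban1985RegularSpaces, p.95 («U₂U₀ = (U₁U₀)^v»), p.77] -/
theorem isPeriodic_mul_gt {P : ℕ} {u w : Site d → 𝔸ˣ} (hu : IsPeriodic P u) (hw : IsPeriodic P w) : IsPeriodic P (u * w) := by
  intro y m
  simp only [Pi.mul_apply, hu y m, hw y m]

end Step

/-! ## §2 The driver with the support AND the periodicity invariants -/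

section Main

variable {𝔸 : Type*} [CStarAlgebra 𝔸] [Nontrivial 𝔸]
variable {L k : ℕ} {η : ℝ} {U₀ U' : Site d → Fin d → 𝔸ˣ} {a cstar α₄ : ℝ}

/-- One level up costs a factor `L` ((1.111) bookkeeping; as in `B8Thm4SupportLocal`). [cite: Balaban1985RegularSpaces, (1.111) p.95] -/
private theorem level_shift (hL1 : 1 ≤ L) (hη : 0 < η) (hc : 0 ≤ cstar) (j : ℕ) :
    cstar * ((L : ℝ) ^ j * η)⁻¹ = L * cstar * ((L : ℝ) ^ (j + 1) * η)⁻¹ ∧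
      cstar * ((L : ℝ) ^ j * η)⁻¹ ≤ L * cstar * ((L : ℝ) ^ j * η)⁻¹ := by
  have hLr : (1 : ℝ) ≤ L := by exact_mod_cast hL1
  have hL0 : (0 : ℝ) < L := by linarith
  have ht : 0 ≤ ((L : ℝ) ^ j * η)⁻¹ := by positivity
  refine ⟨?_, ?_⟩
  · rw [pow_succ]
    field_simp
  · calc cstar * ((L : ℝ) ^ j * η)⁻¹ = 1 * cstar * ((L : ℝ) ^ j * η)⁻¹ := by ring
      _ ≤ L * cstar * ((L : ℝ) ^ j * η)⁻¹ := by gcongr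

/-- ★★ **THEOREM 4's LEVEL INDUCTION WITH THE SUPPORT AND THE PERIODICITY INVARIANTS** — `B8Thm4SupportLocal.thm4_exists_all_levels_supp` re-run for `P`-PERIODIC `U₀`, `U′`
(print's torus `T_η` read on `ℤᵈ`): the Proposition-5 sockets `hP5base` ∕ `hP5` are asked ONLY at a periodic level datum `(u₁, U₁, A)` and DELIVER a periodic `v` (besides the support
clause); the Proposition-3 reset socket `hP3` is asked ONLY at periodic `(u, W, A)`; and the induction produces, at every `m ≤ k`, a unitary gauge transformation `u` with `u = 1` off
`S`, (1.29) at `m` levels, `W = U′^{u⁻¹}` in the gauge `Lan m` with its exponent in the (1.69)∕`c⋆` shape on the bonds `E_j`, `j ≤ m` — `u`, `W` AND the exponent ALL `P`-PERIODIC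
(`u₀ = 1`; `u_{m+1} = u_m·v`; `W = U_m^{v⁻¹}` by the moving-frame action of periodic data; `A′ = (1∕iη) log W` bondwise).  Everything else verbatim (reset by Prop. 3, base datum
`A₀ = (1∕iη) log U′`). [cite: Balaban1985RegularSpaces, Thm 4 p.88, proof pp.88–89 + 94–95, Prop. 5 (1.107)–(1.108) p.94, Prop. 3 p.87, (1.17) p.78, (1.29) p.81, p.77 («Ω_j ⊂ T_η»); Balaban1985Averaging, (55) p.27] -/
theorem thm4_exists_all_levels_supp_per (hL1 : 1 ≤ L) (hη : 0 < η) (S : Set (Site d)) (P : ℕ)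
    (hU₀ : ∀ x κ, U₀ x κ ∈ unitaryUnits 𝔸) (hU' : ∀ x κ, U' x κ ∈ unitaryUnits 𝔸) (hU₀p : IsPeriodic P U₀) (hU'p : IsPeriodic P U')
    (hcstar : 0 ≤ cstar) (hα₄ : 0 ≤ α₄) (hs₁ : α₄ ≤ 1 / 84) (hs₂ : L * cstar ≤ 1 / 12) (ha : a ≤ 1 / 4) (ha2 : 2 * a ≤ cstar)
    (E : ℕ → Set (Site d × Fin d)) (hE : ∀ j, E (j + 1) ⊆ E j)
    (h66 : ∀ b ∈ E 0, ‖((U' b.1 b.2 : 𝔸ˣ) : 𝔸) - 1‖ ≤ a)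
    (Λs : ℕ → ℕ → Set (Site d)) (Lan : ℕ → (Site d → Fin d → 𝔸ˣ) → Prop)
    (hP5base : ∃ (v : Site d → 𝔸ˣ) (lam : Site d → 𝔸), (∀ x, v x ∈ unitaryUnits 𝔸) ∧ (∀ x, x ∉ S → v x = 1) ∧
        (∀ j, j ≤ 1 → ∀ b ∈ E j, (v b.1 : 𝔸) = ((gaugeExp lam b.1 : 𝔸ˣ) : 𝔸) ∧
          (v (b.1 + e b.2) : 𝔸) = ((gaugeExp lam (b.1 + e b.2) : 𝔸ˣ) : 𝔸)) ∧
        (∀ j, j ≤ 1 → ∀ b ∈ E j, ‖lam b.1‖ ≤ α₄ ∧ ((L : ℝ) ^ j * η) * ‖covDerivFwd η U₀ b.2 lam b.1‖ ≤ α₄) ∧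
        Lan 1 (mgauge U₀ v⁻¹ U') ∧ Restr129 L 1 (Λs 1) U₀ ((1 : Site d → 𝔸ˣ) * v) ∧ IsPeriodic P v)
    (hP5 : ∀ m, 1 ≤ m → m < k → ∀ (u₁ : Site d → 𝔸ˣ) (U₁ : Site d → Fin d → 𝔸ˣ) (A : Site d → Fin d → 𝔸),
      (∀ x, u₁ x ∈ unitaryUnits 𝔸) → (∀ x, x ∉ S → u₁ x = 1) → IsPeriodic P u₁ → IsPeriodic P U₁ → IsPeriodic P A →
      mgauge U₀ u₁ U₁ = U' → Restr129 L m (Λs m) U₀ u₁ → Lan m U₁ →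
      (∀ j, j ≤ m → ∀ b ∈ E j, U₁ b.1 b.2 = cfgExp η A b.1 b.2 ∧ IsSelfAdjoint (A b.1 b.2) ∧ ‖A b.1 b.2‖ ≤ cstar * ((L : ℝ) ^ j * η)⁻¹) →
      ∃ (v : Site d → 𝔸ˣ) (lam : Site d → 𝔸), (∀ x, v x ∈ unitaryUnits 𝔸) ∧ (∀ x, x ∉ S → v x = 1) ∧
        (∀ j, j ≤ m + 1 → ∀ b ∈ E j, (v b.1 : 𝔸) = ((gaugeExp lam b.1 : 𝔸ˣ) : 𝔸) ∧
          (v (b.1 + e b.2) : 𝔸) = ((gaugeExp lam (b.1 + e b.2) : 𝔸ˣ) : 𝔸)) ∧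
        (∀ j, j ≤ m + 1 → ∀ b ∈ E j, ‖lam b.1‖ ≤ α₄ ∧ ((L : ℝ) ^ j * η) * ‖covDerivFwd η U₀ b.2 lam b.1‖ ≤ α₄) ∧
        Lan (m + 1) (mgauge U₀ v⁻¹ U₁) ∧ Restr129 L (m + 1) (Λs (m + 1)) U₀ (u₁ * v) ∧ IsPeriodic P v)
    (hP3 : ∀ m, 1 ≤ m → m ≤ k → ∀ (u : Site d → 𝔸ˣ) (W : Site d → Fin d → 𝔸ˣ) (A : Site d → Fin d → 𝔸),
      (∀ x, u x ∈ unitaryUnits 𝔸) → IsPeriodic P u → IsPeriodic P W → IsPeriodic P A →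
      mgauge U₀ u W = U' → Restr129 L m (Λs m) U₀ u → Lan m W →
      (∀ j, j ≤ m → ∀ b ∈ E j, W b.1 b.2 = cfgExp η A b.1 b.2 ∧ ‖A b.1 b.2‖ ≤ (2 * (L * cstar) + 8 * α₄) * ((L : ℝ) ^ j * η)⁻¹) →
      ∀ j, j ≤ m → ∀ b ∈ E j, ‖A b.1 b.2‖ ≤ cstar * ((L : ℝ) ^ j * η)⁻¹) :
    ∀ m, m ≤ k → ∃ u : Site d → 𝔸ˣ, (∀ x, u x ∈ unitaryUnits 𝔸) ∧ (∀ x, x ∉ S → u x = 1) ∧ IsPeriodic P u ∧ Restr129 L m (Λs m) U₀ u ∧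
      ∃ W : Site d → Fin d → 𝔸ˣ, mgauge U₀ u W = U' ∧ (1 ≤ m → Lan m W) ∧ IsPeriodic P W ∧
        ∃ A : Site d → Fin d → 𝔸, IsPeriodic P A ∧ ∀ j, j ≤ m → ∀ b ∈ E j,
          W b.1 b.2 = cfgExp η A b.1 b.2 ∧ IsSelfAdjoint (A b.1 b.2) ∧ ‖A b.1 b.2‖ ≤ cstar * ((L : ℝ) ^ j * η)⁻¹ := by
  have hLc : 0 ≤ L * cstar := by positivity
  -- reading a `c⋆`-bound at levels `≤ m` as an `Lc⋆`-bound at levels `≤ m + 1` (`E` antitone)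
  have hshift : ∀ (m : ℕ) (A : Site d → Fin d → 𝔸),
      (∀ j, j ≤ m → ∀ b ∈ E j, ‖A b.1 b.2‖ ≤ cstar * ((L : ℝ) ^ j * η)⁻¹) →
      ∀ j, j ≤ m + 1 → ∀ b ∈ E j, ‖A b.1 b.2‖ ≤ L * cstar * ((L : ℝ) ^ j * η)⁻¹ := by
    intro m A h j hj b hb
    rcases Nat.lt_or_ge j (m + 1) with hjm | hjm
    · exact (h j (by omega) b hb).trans (level_shift hL1 hη hcstar j).2
    · obtain rfl : j = m + 1 := le_antisymm hj hjm
      have h' := h m le_rfl b (hE m hb)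
      rw [(level_shift hL1 hη hcstar m).1] at h'
      exact h'
  -- THE COMMON TAIL OF A STEP (now carrying periodicity of `u₁, U₁` and of the delivered `v`)
  have tail : ∀ m, m < k → ∀ (u₁ : Site d → 𝔸ˣ) (U₁ : Site d → Fin d → 𝔸ˣ) (A : Site d → Fin d → 𝔸),
      (∀ x, u₁ x ∈ unitaryUnits 𝔸) → (∀ x, x ∉ S → u₁ x = 1) → IsPeriodic P u₁ → IsPeriodic P U₁ → mgauge U₀ u₁ U₁ = U' →
      (∀ j, j ≤ m → ∀ b ∈ E j, U₁ b.1 b.2 = cfgExp η A b.1 b.2 ∧ IsSelfAdjoint (A b.1 b.2) ∧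
        ‖A b.1 b.2‖ ≤ cstar * ((L : ℝ) ^ j * η)⁻¹) →
      ∀ (v : Site d → 𝔸ˣ) (lam : Site d → 𝔸), (∀ x, v x ∈ unitaryUnits 𝔸) → (∀ x, x ∉ S → v x = 1) → IsPeriodic P v →
        (∀ j, j ≤ m + 1 → ∀ b ∈ E j, (v b.1 : 𝔸) = ((gaugeExp lam b.1 : 𝔸ˣ) : 𝔸) ∧
          (v (b.1 + e b.2) : 𝔸) = ((gaugeExp lam (b.1 + e b.2) : 𝔸ˣ) : 𝔸)) →
        (∀ j, j ≤ m + 1 → ∀ b ∈ E j, ‖lam b.1‖ ≤ α₄ ∧ ((L : ℝ) ^ j * η) * ‖covDerivFwd η U₀ b.2 lam b.1‖ ≤ α₄) →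
        Lan (m + 1) (mgauge U₀ v⁻¹ U₁) → Restr129 L (m + 1) (Λs (m + 1)) U₀ (u₁ * v) →
      ∃ u : Site d → 𝔸ˣ, (∀ x, u x ∈ unitaryUnits 𝔸) ∧ (∀ x, x ∉ S → u x = 1) ∧ IsPeriodic P u ∧ Restr129 L (m + 1) (Λs (m + 1)) U₀ u ∧
        ∃ W : Site d → Fin d → 𝔸ˣ, mgauge U₀ u W = U' ∧ (1 ≤ m + 1 → Lan (m + 1) W) ∧ IsPeriodic P W ∧
          ∃ A' : Site d → Fin d → 𝔸, IsPeriodic P A' ∧ ∀ j, j ≤ m + 1 → ∀ b ∈ E j,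
            W b.1 b.2 = cfgExp η A' b.1 b.2 ∧ IsSelfAdjoint (A' b.1 b.2) ∧ ‖A' b.1 b.2‖ ≤ cstar * ((L : ℝ) ^ j * η)⁻¹ := by
    intro m hmk u₁ U₁ A hu₁ hu₁S hu₁p hU₁p hU₁ hA v lam hv hvS hvp hvlam h108 hLan h129
    -- `U₁ = e^{iηA}` and (1.69) with `c = Lc⋆` on `E j`, `j ≤ m + 1`
    have hAexp : ∀ j, j ≤ m + 1 → ∀ b ∈ E j, U₁ b.1 b.2 = cfgExp η A b.1 b.2 := by
      intro j hj b hb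
      rcases Nat.lt_or_ge j (m + 1) with hjm | hjm
      · exact (hA j (by omega) b hb).1
      · obtain rfl : j = m + 1 := le_antisymm hj hjm
        exact (hA m le_rfl b (hE m hb)).1
    have h69 := hshift m A (fun j hj b hb => (hA j hj b hb).2.2)
    obtain ⟨hu, huS, h29, hW, hLanW, hA'⟩ := thm4_exists_step_onBonds_supp_explicit (k := m + 1) (Λ := Λs (m + 1)) hL1 hη
      hU₀ hU' hu₁ hv S hu₁S hvS hLc hα₄ hs₁ hs₂ hU₁ E hAexp h69 hvlam h108 (Lan (m + 1)) hLan h129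
    -- the three periodicity threads of the step
    have hup : IsPeriodic P (u₁ * v) := isPeriodic_mul_gt hu₁p hvp
    have hWp : IsPeriodic P (mgauge U₀ v⁻¹ U₁) := isPeriodic_mgauge hU₀p (isPeriodic_inv hvp) hU₁p
    have hA'p : IsPeriodic P (fun y μ => η⁻¹ • ((I⁻¹ : ℂ) • mlog ((mgauge U₀ v⁻¹ U₁ y μ : 𝔸ˣ) : 𝔸))) := isPeriodic_logW η hWp
    -- Proposition 3 at level `m + 1` (AT PERIODIC DATA): reset the constant `2Lc⋆ + 8α₄ ↦ c⋆`
    have hreset := hP3 (m + 1) (by omega) (by omega) (u₁ * v) (mgauge U₀ v⁻¹ U₁) _ hu hup hWp hA'p hW h29 hLanW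
      (fun j hj b hb => ⟨(hA' j hj b hb).1, (hA' j hj b hb).2.2⟩)
    exact ⟨u₁ * v, hu, huS, hup, h29, mgauge U₀ v⁻¹ U₁, hW, fun _ => hLanW, hWp, _, hA'p,
      fun j hj b hb => ⟨(hA' j hj b hb).1, (hA' j hj b hb).2.1, hreset j hj b hb⟩⟩
  -- THE BASE DATUM: `u = 1`, `W = U′`, `A₀ = (1/iη) log U′` — all periodic
  have base : ∀ j, j ≤ 0 → ∀ b ∈ E j,
      U' b.1 b.2 = cfgExp η (fun y μ => η⁻¹ • ((I⁻¹ : ℂ) • mlog ((U' y μ : 𝔸ˣ) : 𝔸))) b.1 b.2 ∧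
        IsSelfAdjoint ((fun y μ => η⁻¹ • ((I⁻¹ : ℂ) • mlog ((U' y μ : 𝔸ˣ) : 𝔸))) b.1 b.2) ∧
        ‖(fun y μ => η⁻¹ • ((I⁻¹ : ℂ) • mlog ((U' y μ : 𝔸ˣ) : 𝔸))) b.1 b.2‖ ≤ cstar * ((L : ℝ) ^ j * η)⁻¹ := by
    intro j hj b hb
    obtain rfl : j = 0 := Nat.le_zero.mp hj
    obtain ⟨-, hexp, hsa, hbd⟩ := base_datum hη U₀ U' hU' ha b.1 b.2 (h66 b hb)
    refine ⟨hexp, hsa, hbd.trans ?_⟩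
    rw [pow_zero, one_mul]
    exact mul_le_mul_of_nonneg_right ha2 (inv_nonneg.mpr hη.le)
  have hone : mgauge U₀ (1 : Site d → 𝔸ˣ) U' = U' := by
    funext z μ; simp [mgauge_apply]
  have h1p : IsPeriodic P (1 : Site d → 𝔸ˣ) := isPeriodic_const (1 : 𝔸ˣ)
  intro m
  induction m with
  | zero =>
    intro _
    exact ⟨1, fun x => (unitaryUnits 𝔸).one_mem, fun _ _ => rfl, h1p, restr129_one L 0 (Λs 0) U₀, U', hone, fun h => absurd h (by omega), hU'p,
      _, isPeriodic_logW η hU'p, base⟩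
  | succ m ih =>
    intro hmk
    rcases Nat.eq_zero_or_pos m with rfl | hm
    · -- the first step («k = 1»): Proposition 5 for the base datum
      obtain ⟨v, lam, hv, hvS, hvlam, h108, hLan, h129, hvp⟩ := hP5base
      exact tail 0 (by omega) 1 U' _ (fun x => (unitaryUnits 𝔸).one_mem) (fun _ _ => rfl) h1p hU'p hone base v lam hv hvS hvp hvlam h108 hLan h129
    · -- the general step: Proposition 5 for the (periodic) datum delivered at level `m`
      obtain ⟨u₁, hu₁, hu₁S, hu₁p, h129₁, U₁, hU₁, hLan₁, hU₁p, A, hAp, hA⟩ := ih (by omega)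
      obtain ⟨v, lam, hv, hvS, hvlam, h108, hLan, h129, hvp⟩ :=
        hP5 m hm (by omega) u₁ U₁ A hu₁ hu₁S hu₁p hU₁p hAp hU₁ h129₁ (hLan₁ hm) hA
      exact tail m (by omega) u₁ U₁ A hu₁ hu₁S hu₁p hU₁p hU₁ hA v lam hv hvS hvp hvlam h108 hLan h129

end Main

end Literature.MathematicalPhysics.QuantumFieldTheory.Balaban1983to89.B8Thm4SupportLocalPer

end
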